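/-
Copyright (c) 2026 the pub-hodgecm-mathlib formalisation cell (harness21).  Prover seat hodgecm-mathlib-F0P2-p06 (g12): road «S3-ram» (LEAD F0P3a-plan (g12); architect
A-p16 (g31); owner F0P3a-p06 (g15)), organ A′ (ii) J6 «LOCAL LAW IN ENGINE SHAPE», binder hB «BOUNDARY VERTICES ARE LEAVES»; 2026-09-02.
-/
import Literature.NumberTheory.Automorphic.UnitaryLatticeTreeRootStarNullIsotropicCountRamified   -- ★ p847330 (this seat): G3′ (dictionary star(L₀) ↔ isotropic points; brings ★ G3⁺, ★ G3, ★ R2b)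
import Literature.NumberTheory.Automorphic.UnitaryLatticeTreeFixedChildTokensRamified            -- ★ p847340 (F0P2-p01 (g15)): FILE H §0 `map_toLin'_latt_le_scaleLattice_iff` (tokens ↔ entries)
import HarnessLib

/-!
# The lattice graph of a hermitian space — LEVEL ZERO: a fixed self-dual vertex on which `γ` is residually a non-trivial unipotent has exactly ONE fixed neighbour
# (its parent), hence no fixed grandchildren — «boundary vertices of the fixed subtree are leaves» (Bruhat–Tits 1972 §10; Tits 1979 §3.5; Serre, *Trees* II.1.1)

Topic `NumberTheory/Automorphic`; namespace `Literature.NumberTheory.Automorphic.UnitaryLatticeTree`.  THEOREMS ONLY (no definition, no instance, no notation, no named fact,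
no `sorry`); kernel lane `--supports stmt-HodgeConjecture-24833`.  Cell `pub/hodgecm-mathlib` (D-0151), crux H413; road «S3-ram» (Literature seeding), organ A′ (ii) of the
P-1-ram skeleton (architect A-p16 (g31)), junction gap J6 of F0P3a-p01 (g16)'s J-PACK, binder **`hB`** of the tree-induction engine `strataVec_cone_eq_of_localLaw`:
`∀ v ∈ F, SD v → v ≠ r → dep v = 0 → GC v = ∅` — at a fixed self-dual vertex `v` of DEPTH LABEL `0` (`(γ − 1)·v ⊄ ϖ·v`: `γ` acts on the star of `v` as a residually
NON-TRIVIAL unipotent `γ̄′`, `γ′ = u⁻¹γu`, `v = u·L₀`) no grandchild is fixed.  REASON: a neighbour `(uκ)·N₁` of `v` is fixed iff the isotropic residual point `x̄ = κ̄ē₀`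
is an EIGENVECTOR of `γ̄′` (★ T2-E′ `latticeGraphIso_N₁_eq_iff`); `γ̄′` unipotent forces the eigenvalue `1`, i.e. `x̄ ∈ ker(γ̄′ − 1)`, a LINE because `(γ̄′ − 1)² ≠ 0`
(★ `mul_self_eq_zero_of_rank_le_one_of_isNilpotent`: in `O₃` there are no transvections — the (a2) sheet's «rank 2 at depth 0», ★ NO-TV); two fixed neighbours would give
proportional `x̄`, hence the same hyperplane `N_x`, hence the same neighbour (★ G3′ dictionary).  So the only fixed neighbour of `v ≠ r` is its PARENT (fixed by ★
`parentClosed_fixedPoints`), no CHILD of `v` is fixed, and `GC(v) = ∅`.  HYPOTHESES in the (a2) TOKENS: `¬ (γ − 1)²·v ⊆ ϖ·v` (= rank 2 at level 0) and `(γ − 1)³·v ⊆ ϖ·v`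
(residual nilpotency, automatic for the normalised literal); ★ FILE H `map_toLin'_latt_le_scaleLattice_iff` reads them on `u⁻¹γu`.

* §1 residual linear algebra (any field): `eq_zero_of_mulVec_eq_smul_of_pow_three_eq_zero` (a nilpotent has no non-zero eigenvalue), `exists_smul_eq_of_mulVec_eq_zero_of_sq_ne_zero`
  (`N³ = 0 ≠ N²` on `F³`: the kernel is a line).
* §2 `exists_residue_mulVec_eq_smul_of_latticeGraphIso_N₁_eq` (a fixed neighbour `κ·N₁` gives a residual eigenvector `κ̄ē₀` of `γ̄′ − 1` with eigenvalue `c̄ − 1`).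
* §3 **`latticeGraphIso_N₁_eq_unique_of_levelZero`** (at the root: two fixed neighbours coincide), **`fixed_neighbor_unique_of_levelZero`** (at `u·L₀`).
* §4 **`fixedGrandchildren_eq_empty_of_levelZero`** — the engine's `hB` VERBATIM shape `{w | ∃ c, (v ~ c ∧ dist(r,c) = dist(r,v)+1 ∧ γ·c = c) ∧ (c ~ w ∧ … ∧ γ·w = w)} = ∅`
  from the two tokens (`γ ∈ K₀`, `hT`).

HONEST LABEL: HC_CM is proved only modulo the 2 remaining named inputs (hLiu418 24832, h413 24833) until rung 0 closes; nothing printed is asserted here (residual linear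
algebra over ★ results); «S3-ram» has no books consequence.

## References
* [BruhatTits1972] F. Bruhat, J. Tits, *Groupes réductifs sur un corps local I*, Publ. Math. IHÉS 41 (1972), §10 (the action of a vertex stabiliser on its star factors
  through the residual group).
* [Tits1979] J. Tits, *Reductive groups over local fields*, PSPM 33.1 (1979), §3.5 (reduction mod `𝔭`), §2.4 (ramified `U(3)`: the residual group at a self-dual vertex is `O₃`).
* [Serre1980Trees] J.-P. Serre, *Trees* (1980), Ch. II §1.1 (fixed points on the projective line over the residue field), Ch. I §6.4.
* [Kottwitz1986] R. E. Kottwitz, *Base change for unit elements of Hecke algebras*, Compositio Math. 60 (1986), §3 (boundary of the fixed-lattice set).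
-/

set_option autoImplicit false

noncomputable section

open scoped Valued WithZero Matrix MatrixGroups

namespace Literature.NumberTheory.Automorphic.UnitaryLatticeTree

open Literature.NumberTheory.Automorphic Literature.NumberTheory.Automorphic.HermitianLattice
open Literature.NumberTheory.Automorphic.CartanUnique Literature.NumberTheory.Automorphic.UnitaryGroup
open Literature.GroupTheory.SpecificGroups
open Literature.Combinatorics.SimpleGraph.TreeLayers

variable {K : Type*} [Field K] [Valued K ℤᵐ⁰] {σ : K →+* K} {ϖ : K}

/-! ## §1 Residual linear algebra: a nilpotent `N` with `N² ≠ 0` on `F³` -/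

section Residual

variable {F : Type*} [Field F]

/-- **A nilpotent matrix has no non-zero eigenvalue**: `N³ = 0`, `N x = μ x`, `x ≠ 0` ⇒ `μ = 0`. [cite: Serre1980Trees, II.1.1] -/
theorem eq_zero_of_mulVec_eq_smul_of_pow_three_eq_zero {N : Matrix (Fin 3) (Fin 3) F} (h3 : N ^ 3 = 0) {x : Fin 3 → F} (hx : x ≠ 0) {μ : F}
    (h : N *ᵥ x = μ • x) : μ = 0 := by
  have h2 : (N ^ 2) *ᵥ x = (μ ^ 2) • x := by
    rw [pow_two, pow_two, ← Matrix.mulVec_mulVec, h, Matrix.mulVec_smul, h, smul_smul]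
  have h3' : (N ^ 3) *ᵥ x = (μ ^ 3) • x := by
    rw [pow_succ, pow_succ μ, ← Matrix.mulVec_mulVec, h, Matrix.mulVec_smul, h2, smul_smul, mul_comm]
  rw [h3, Matrix.zero_mulVec] at h3'
  have hμ3 : μ ^ 3 = 0 := by
    by_contra hne
    exact hx ((smul_eq_zero.1 h3'.symm).resolve_left hne)
  exact pow_eq_zero_iff (n := 3) (by norm_num) |>.1 hμ3

/-- **`N³ = 0 ≠ N²` on `F³`: the kernel of `N` is a line** — two kernel vectors, the first non-zero, are proportional (rank `N ≥ 2` since a rank-`≤ 1` nilpotent has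
`N² = 0`, ★ `mul_self_eq_zero_of_rank_le_one_of_isNilpotent`; rank–nullity). [cite: Serre1980Trees, II.1.1] [cite: Tits1979, §3.5] -/
theorem exists_smul_eq_of_mulVec_eq_zero_of_sq_ne_zero {N : Matrix (Fin 3) (Fin 3) F} (h3 : N ^ 3 = 0) (h2 : N ^ 2 ≠ 0)
    {x x' : Fin 3 → F} (hx : x ≠ 0) (hNx : N *ᵥ x = 0) (hNx' : N *ᵥ x' = 0) : ∃ c : F, x' = c • x := by
  classical
  -- rank `N ≥ 2`
  have hrank : 2 ≤ N.rank := by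
    by_contra hlt
    have h1 : N.rank ≤ 1 := by omega
    have hsq := mul_self_eq_zero_of_rank_le_one_of_isNilpotent h1 ⟨3, h3⟩
    exact h2 (by rw [pow_two]; exact hsq)
  -- the kernel has dimension `≤ 1`
  have hker : Module.finrank F (LinearMap.ker N.mulVecLin) ≤ 1 := by
    have hrn := LinearMap.finrank_range_add_finrank_ker N.mulVecLin
    rw [Module.finrank_fintype_fun_eq_card, Fintype.card_fin] at hrn
    change N.rank + Module.finrank F (LinearMap.ker N.mulVecLin) = 3 at hrn
    omega
  obtain ⟨v, hv⟩ := finrank_le_one_iff.1 hker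
  have hxk : x ∈ LinearMap.ker N.mulVecLin := by rw [LinearMap.mem_ker, Matrix.mulVecLin_apply]; exact hNx
  have hx'k : x' ∈ LinearMap.ker N.mulVecLin := by rw [LinearMap.mem_ker, Matrix.mulVecLin_apply]; exact hNx'
  obtain ⟨a, ha⟩ := hv ⟨x, hxk⟩
  obtain ⟨b, hb⟩ := hv ⟨x', hx'k⟩
  have ha' : a • (v : Fin 3 → F) = x := by simpa using congrArg Subtype.val ha
  have hb' : b • (v : Fin 3 → F) = x' := by simpa using congrArg Subtype.val hb
  have ha0 : a ≠ 0 := by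
    rintro rfl
    rw [zero_smul] at ha'
    exact hx ha'.symm
  refine ⟨b * a⁻¹, ?_⟩
  rw [← hb', ← ha', smul_smul, mul_assoc, inv_mul_cancel₀ ha0, mul_one]

end Residual

/-! ## §2 A fixed neighbour of the root gives a residual eigenvector -/

/-- **A FIXED NEIGHBOUR `κ·N₁` OF THE ROOT GIVES A RESIDUAL EIGENVECTOR**: if `γ ∈ K₀` fixes `κ·N₁` (`κ ∈ K₀`) then `x̄ = κ̄ē₀` satisfies `(γ̄ − 1) x̄ = μ x̄` for some `μ ∈ 𝓀`
(★ T2-E′ `latticeGraphIso_N₁_eq_iff`: `γκe₀ ≡ c·κe₀ (mod 𝔪)`, `μ = c̄ − 1`). `γ − 1` and `κe₀` enter through `𝒪`-valued binders. [cite: Tits1979, §3.5] [cite: BruhatTits1972, §10] -/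
theorem exists_residue_mulVec_eq_smul_of_latticeGraphIso_N₁_eq (hvσ : ∀ a, Valued.v (σ a) = Valued.v a) (hσϖ : σ ϖ = -ϖ)
    (hϖ : Valued.v ϖ = WithZero.exp (-1 : ℤ)) {γ κ : unitaryGroupOfForm σ ((StdForm.antidiagonal 3).over K)} (hγ : γ ∈ unitaryInt σ ((StdForm.antidiagonal 3).over K)) (hκ : κ ∈ unitaryInt σ ((StdForm.antidiagonal 3).over K))
    (N₀ : Matrix (Fin 3) (Fin 3) 𝒪[K]) (hN₀ : ∀ i j, ((N₀ i j : 𝒪[K]) : K) = ((((γ : GL (Fin 3) K) : Matrix (Fin 3) (Fin 3) K) - 1) i j))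
    (x₀ : Fin 3 → 𝒪[K]) (hx₀ : ∀ i, ((x₀ i : 𝒪[K]) : K) = ((κ : GL (Fin 3) K) : Matrix (Fin 3) (Fin 3) K) i 0)
    (hfix : latticeGraphIso σ ϖ ((StdForm.antidiagonal 3).over K) γ (latticeGraphIso σ ϖ ((StdForm.antidiagonal 3).over K) κ ⟨latt (Matrix.diagonal ![(1 : K), 1, ϖ]), 2, isVertexLattice_two_N₁_of_neg hσϖ hϖ⟩) = latticeGraphIso σ ϖ ((StdForm.antidiagonal 3).over K) κ ⟨latt (Matrix.diagonal ![(1 : K), 1, ϖ]), 2, isVertexLattice_two_N₁_of_neg hσϖ hϖ⟩) :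
    ∃ μ : 𝓀[K], (N₀.map (IsLocalRing.residue 𝒪[K])) *ᵥ (fun i => IsLocalRing.residue 𝒪[K] (x₀ i)) = μ • (fun i => IsLocalRing.residue 𝒪[K] (x₀ i)) := by
  obtain ⟨c, hc, hcong⟩ := (latticeGraphIso_N₁_eq_iff hvσ hϖ hγ hκ _ rfl).1 hfix
  have cO : c ∈ 𝒪[K] := (Valuation.mem_integer_iff _ _).2 hc.le
  refine ⟨IsLocalRing.residue 𝒪[K] ⟨c, cO⟩ - 1, ?_⟩
  funext i
  -- the congruence at `i` is the vanishing of the residue of an element of `𝒪`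
  have hE : (((γ : GL (Fin 3) K) : Matrix (Fin 3) (Fin 3) K) * ((κ : GL (Fin 3) K) : Matrix (Fin 3) (Fin 3) K)) i 0 - c * ((κ : GL (Fin 3) K) : Matrix (Fin 3) (Fin 3) K) i 0 =
      (((∑ j, (N₀ i j + (1 : Matrix (Fin 3) (Fin 3) 𝒪[K]) i j) * x₀ j) - ⟨c, cO⟩ * x₀ i : 𝒪[K]) : K) := by
    have hγij : ∀ j, ((γ : GL (Fin 3) K) : Matrix (Fin 3) (Fin 3) K) i j = ((N₀ i j : 𝒪[K]) : K) + ((1 : Matrix (Fin 3) (Fin 3) 𝒪[K]) i j : 𝒪[K]) := by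
      intro j
      rw [hN₀, Matrix.sub_apply]
      by_cases hij : i = j
      · subst hij; simp
      · simp [Matrix.one_apply_ne hij]
    rw [Matrix.mul_apply]
    push_cast
    simp only [hγij, hx₀]
  have hres : IsLocalRing.residue 𝒪[K] ((∑ j, (N₀ i j + (1 : Matrix (Fin 3) (Fin 3) 𝒪[K]) i j) * x₀ j) - ⟨c, cO⟩ * x₀ i) = 0 := by
    rw [residue_eq_zero_iff_v_lt_one, ← hE]; exact hcong i
  rw [map_sub, map_sum, sub_eq_zero] at hres
  simp only [map_mul, map_add] at hres
  -- read off `(N̄ x̄) i = (c̄ − 1) x̄ i`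
  rw [Pi.smul_apply, smul_eq_mul, sub_mul, one_mul, ← hres, Matrix.mulVec, dotProduct]
  simp only [Matrix.map_apply, add_mul, Finset.sum_add_distrib]
  have h1 : ∑ j, IsLocalRing.residue 𝒪[K] ((1 : Matrix (Fin 3) (Fin 3) 𝒪[K]) i j) * IsLocalRing.residue 𝒪[K] (x₀ j) = IsLocalRing.residue 𝒪[K] (x₀ i) := by
    rw [Finset.sum_eq_single i]
    · rw [Matrix.one_apply_eq, map_one, one_mul]
    · intro j _ hj; rw [Matrix.one_apply_ne (Ne.symm hj), map_zero, zero_mul]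
    · intro h; exact absurd (Finset.mem_univ _) h
  rw [h1]
  ring

/-! ## §3 Level zero: at most one fixed neighbour -/

/-- **LEVEL ZERO, AT THE ROOT: TWO FIXED NEIGHBOURS COINCIDE.**  Let `γ ∈ K₀` with `N̄ = (γ − 1) mod ϖ` satisfying `N̄³ = 0 ≠ N̄²` (residually a REGULAR unipotent — the only
non-trivial unipotents of `O₃`).  If `γ` fixes the neighbours `κ·N₁` and `κ′·N₁` of `L₀` then `κ·N₁ = κ′·N₁`: both `κ̄ē₀`, `κ̄′ē₀` lie on the LINE `ker N̄` (§1–§2), so the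
hyperplanes `N_{κe₀} = N_{κ′e₀}` agree (★ G3′ dictionary). [cite: Tits1979, §3.5] [cite: BruhatTits1972, §10] [cite: Serre1980Trees, II.1.1] -/
theorem latticeGraphIso_N₁_eq_unique_of_levelZero (hvσ : ∀ a, Valued.v (σ a) = Valued.v a) (hσϖ : σ ϖ = -ϖ)
    (hϖ : Valued.v ϖ = WithZero.exp (-1 : ℤ)) {γ κ κ' : unitaryGroupOfForm σ ((StdForm.antidiagonal 3).over K)} (hγ : γ ∈ unitaryInt σ ((StdForm.antidiagonal 3).over K)) (hκ : κ ∈ unitaryInt σ ((StdForm.antidiagonal 3).over K)) (hκ' : κ' ∈ unitaryInt σ ((StdForm.antidiagonal 3).over K))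
    (N₀ : Matrix (Fin 3) (Fin 3) 𝒪[K]) (hN₀ : ∀ i j, ((N₀ i j : 𝒪[K]) : K) = ((((γ : GL (Fin 3) K) : Matrix (Fin 3) (Fin 3) K) - 1) i j))
    (h3 : (N₀.map (IsLocalRing.residue 𝒪[K])) ^ 3 = 0) (h2 : (N₀.map (IsLocalRing.residue 𝒪[K])) ^ 2 ≠ 0)
    (hfix : latticeGraphIso σ ϖ ((StdForm.antidiagonal 3).over K) γ (latticeGraphIso σ ϖ ((StdForm.antidiagonal 3).over K) κ ⟨latt (Matrix.diagonal ![(1 : K), 1, ϖ]), 2, isVertexLattice_two_N₁_of_neg hσϖ hϖ⟩) = latticeGraphIso σ ϖ ((StdForm.antidiagonal 3).over K) κ ⟨latt (Matrix.diagonal ![(1 : K), 1, ϖ]), 2, isVertexLattice_two_N₁_of_neg hσϖ hϖ⟩)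
    (hfix' : latticeGraphIso σ ϖ ((StdForm.antidiagonal 3).over K) γ (latticeGraphIso σ ϖ ((StdForm.antidiagonal 3).over K) κ' ⟨latt (Matrix.diagonal ![(1 : K), 1, ϖ]), 2, isVertexLattice_two_N₁_of_neg hσϖ hϖ⟩) = latticeGraphIso σ ϖ ((StdForm.antidiagonal 3).over K) κ' ⟨latt (Matrix.diagonal ![(1 : K), 1, ϖ]), 2, isVertexLattice_two_N₁_of_neg hσϖ hϖ⟩) :
    latticeGraphIso σ ϖ ((StdForm.antidiagonal 3).over K) κ ⟨latt (Matrix.diagonal ![(1 : K), 1, ϖ]), 2, isVertexLattice_two_N₁_of_neg hσϖ hϖ⟩ = latticeGraphIso σ ϖ ((StdForm.antidiagonal 3).over K) κ' ⟨latt (Matrix.diagonal ![(1 : K), 1, ϖ]), 2, isVertexLattice_two_N₁_of_neg hσϖ hϖ⟩ := by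
  have hϖ0 : ϖ ≠ 0 := uniformizer_ne_zero hϖ
  have hlt1 : ∀ z : K, Valued.v z < 1 ↔ Valued.v z ≤ Valued.v ϖ := fun z => by rw [hϖ]; exact v_lt_one_iff z
  -- the two first columns, integrally and residually
  have hκO : ∀ i, ((κ : GL (Fin 3) K) : Matrix (Fin 3) (Fin 3) K) i 0 ∈ 𝒪[K] := fun i => (Valuation.mem_integer_iff _ _).2 ((mem_unitaryInt_iff.1 hκ).1 i 0)
  have hκ'O : ∀ i, ((κ' : GL (Fin 3) K) : Matrix (Fin 3) (Fin 3) K) i 0 ∈ 𝒪[K] := fun i => (Valuation.mem_integer_iff _ _).2 ((mem_unitaryInt_iff.1 hκ').1 i 0)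
  set x₀ : Fin 3 → 𝒪[K] := fun i => ⟨_, hκO i⟩ with hx₀
  set x₀' : Fin 3 → 𝒪[K] := fun i => ⟨_, hκ'O i⟩ with hx₀'
  obtain ⟨μ, hμ⟩ := exists_residue_mulVec_eq_smul_of_latticeGraphIso_N₁_eq hvσ hσϖ hϖ hγ hκ N₀ hN₀ x₀ (fun _ => rfl) hfix
  obtain ⟨μ', hμ'⟩ := exists_residue_mulVec_eq_smul_of_latticeGraphIso_N₁_eq hvσ hσϖ hϖ hγ hκ' N₀ hN₀ x₀' (fun _ => rfl) hfix'
  -- both residual vectors are non-zero (primitivity of `κe₀`)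
  have hxne : (fun i => IsLocalRing.residue 𝒪[K] (x₀ i)) ≠ 0 := by
    refine (exists_v_eq_one_iff_residue_ne_zero x₀).1 ?_
    obtain ⟨-, -, ⟨j, hj⟩⟩ := firstColumn_props (K := K) hκ
    exact ⟨j, by rw [← col_zero_eq_mulVec_single] at hj; exact hj⟩
  have hxne' : (fun i => IsLocalRing.residue 𝒪[K] (x₀' i)) ≠ 0 := by
    refine (exists_v_eq_one_iff_residue_ne_zero x₀').1 ?_
    obtain ⟨-, -, ⟨j, hj⟩⟩ := firstColumn_props (K := K) hκ'
    exact ⟨j, by rw [← col_zero_eq_mulVec_single] at hj; exact hj⟩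
  -- eigenvalues vanish, both vectors are in the kernel, hence proportional
  have hμ0 := eq_zero_of_mulVec_eq_smul_of_pow_three_eq_zero h3 hxne hμ
  have hμ0' := eq_zero_of_mulVec_eq_smul_of_pow_three_eq_zero h3 hxne' hμ'
  rw [hμ0, zero_smul] at hμ
  rw [hμ0', zero_smul] at hμ'
  obtain ⟨cbar, hcbar⟩ := exists_smul_eq_of_mulVec_eq_zero_of_sq_ne_zero h3 h2 hxne hμ hμ'
  have hc0 : cbar ≠ 0 := by
    rintro rfl; rw [zero_smul] at hcbar; exact hxne' hcbar
  -- lift `c̄` to a unit and get `κ′e₀ ≡ e·κe₀ (mod 𝔪)`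
  obtain ⟨e, he⟩ := IsLocalRing.residue_surjective cbar
  have he1 : Valued.v (e : K) = 1 := by
    refine le_antisymm e.2 (not_lt.1 fun hlt => hc0 ?_)
    rw [← he, residue_eq_zero_iff_v_lt_one]; exact hlt
  have hcong : ∃ e' : K, Valued.v e' = 1 ∧ ∀ i, Valued.v (((κ' : GL (Fin 3) K) : Matrix (Fin 3) (Fin 3) K) i 0 - e' * ((κ : GL (Fin 3) K) : Matrix (Fin 3) (Fin 3) K) i 0) < 1 := by
    refine ⟨(e : K), he1, fun i => ?_⟩
    have hi := congrFun hcbar i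
    simp only [Pi.smul_apply, smul_eq_mul] at hi
    have : Valued.v (((x₀' i - e * x₀ i : 𝒪[K])) : K) < 1 := by
      rw [← residue_eq_zero_iff_v_lt_one, map_sub, map_mul, he, hi, sub_self]
    simpa using this
  -- equal hyperplanes ⇒ equal vertices
  have hiff := forall_v_B₀_lt_one_iff_of_exists_unit_congr hvσ (N := 3) hcong
  refine eq_of_forall_mem_iff fun y => ?_
  rw [latticeGraphIso_apply_val, latticeGraphIso_apply_val]
  constructor
  · intro hy
    have hyL : y ∈ stdLattice K 3 := (mapGL_N₁_le hκ (uniformizer_mem_integer hϖ) hϖ0).2 hy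
    have h1 := (mem_mapGL_N₁_iff hκ hϖ0 hyL).1 hy
    rw [← col_zero_eq_mulVec_single] at h1
    refine (mem_mapGL_N₁_iff hκ' hϖ0 hyL).2 ?_
    rw [← col_zero_eq_mulVec_single, ← hlt1]
    exact (hiff y hyL).2 ((hlt1 _).2 h1)
  · intro hy
    have hyL : y ∈ stdLattice K 3 := (mapGL_N₁_le hκ' (uniformizer_mem_integer hϖ) hϖ0).2 hy
    have h1 := (mem_mapGL_N₁_iff hκ' hϖ0 hyL).1 hy
    rw [← col_zero_eq_mulVec_single] at h1
    refine (mem_mapGL_N₁_iff hκ hϖ0 hyL).2 ?_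
    rw [← col_zero_eq_mulVec_single, ← hlt1]
    exact (hiff y hyL).1 ((hlt1 _).2 h1)

/-- **LEVEL ZERO AT A GENERAL VERTEX `v = u·L₀`: AT MOST ONE FIXED NEIGHBOUR** (`γ′ = u⁻¹γu ∈ K₀` with `(γ̄′ − 1)³ = 0 ≠ (γ̄′ − 1)²`): two neighbours of `v` fixed by `γ`
coincide (§3 at the root, transported along `u`). [cite: Tits1979, §3.5] [cite: BruhatTits1972, §10] -/
theorem fixed_neighbor_unique_of_levelZero (hσ : ∀ x, σ (σ x) = x) (hvσ : ∀ a, Valued.v (σ a) = Valued.v a) (hσϖ : σ ϖ = -ϖ)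
    (hϖ : Valued.v ϖ = WithZero.exp (-1 : ℤ)) (h2 : Valued.v (2 : K) = 1)
    {γ u : unitaryGroupOfForm σ ((StdForm.antidiagonal 3).over K)} (hγK : u⁻¹ * γ * u ∈ unitaryInt σ ((StdForm.antidiagonal 3).over K))
    (N₀ : Matrix (Fin 3) (Fin 3) 𝒪[K])
    (hN₀ : ∀ i j, ((N₀ i j : 𝒪[K]) : K) = (((((u⁻¹ * γ * u : unitaryGroupOfForm σ ((StdForm.antidiagonal 3).over K))) : GL (Fin 3) K) : Matrix (Fin 3) (Fin 3) K) - 1) i j)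
    (h3 : (N₀.map (IsLocalRing.residue 𝒪[K])) ^ 3 = 0) (hsq : (N₀.map (IsLocalRing.residue 𝒪[K])) ^ 2 ≠ 0)
    {c c' : {M : Submodule 𝒪[K] (Fin 3 → K) // IsVertex σ ϖ ((StdForm.antidiagonal 3).over K) M}}
    (hc : c ∈ (latticeGraph σ ϖ ((StdForm.antidiagonal 3).over K)).neighborSet (latticeGraphIso σ ϖ ((StdForm.antidiagonal 3).over K) u ⟨stdLattice K 3, 0, isSelfDualLattice_stdLattice_three_of_v hϖ⟩)) (hc' : c' ∈ (latticeGraph σ ϖ ((StdForm.antidiagonal 3).over K)).neighborSet (latticeGraphIso σ ϖ ((StdForm.antidiagonal 3).over K) u ⟨stdLattice K 3, 0, isSelfDualLattice_stdLattice_three_of_v hϖ⟩))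
    (hfc : latticeGraphIso σ ϖ ((StdForm.antidiagonal 3).over K) γ c = c) (hfc' : latticeGraphIso σ ϖ ((StdForm.antidiagonal 3).over K) γ c' = c') : c = c' := by
  have hfixiff : ∀ w : {M : Submodule 𝒪[K] (Fin 3 → K) // IsVertex σ ϖ ((StdForm.antidiagonal 3).over K) M},
      latticeGraphIso σ ϖ ((StdForm.antidiagonal 3).over K) γ (latticeGraphIso σ ϖ ((StdForm.antidiagonal 3).over K) u w) = latticeGraphIso σ ϖ ((StdForm.antidiagonal 3).over K) u w ↔ latticeGraphIso σ ϖ ((StdForm.antidiagonal 3).over K) (u⁻¹ * γ * u) w = w := by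
    intro w
    rw [latticeGraphIso_eq_iff_mapGL_eq, mapGL_latticeGraphIso_eq_iff, latticeGraphIso_eq_iff_mapGL_eq]
  obtain ⟨κ, hκ, rfl⟩ := (mem_neighborSet_latticeGraphIso_root_iff hσ hvσ hσϖ hϖ h2 u c).1 hc
  obtain ⟨κ', hκ', rfl⟩ := (mem_neighborSet_latticeGraphIso_root_iff hσ hvσ hσϖ hϖ h2 u c').1 hc'
  rw [latticeGraphIso_mul_apply] at hfc hfc' ⊢
  rw [latticeGraphIso_mul_apply]
  rw [hfixiff] at hfc hfc'
  rw [latticeGraphIso_N₁_eq_unique_of_levelZero hvσ hσϖ hϖ hγK hκ hκ' N₀ hN₀ h3 hsq hfc hfc']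

/-! ## §4 The engine's `hB`: no fixed grandchildren at a level-zero vertex -/

/-- **`hB` — BOUNDARY VERTICES OF THE FIXED SUBTREE ARE LEAVES**: let `γ ∈ K₀` and `v ≠ r` a fixed self-dual vertex of DEPTH LABEL `0` in the (a2) tokens:
`¬ (γ − 1)²·v ⊆ ϖ·v` (rank 2 at level 0 — ★ NO-TV) and `(γ − 1)³·v ⊆ ϖ·v` (residual nilpotency).  Then the set `GC(v)` of fixed grandchildren of the tree-induction
engine is EMPTY: the parent of `v` is fixed (★ `parentClosed_fixedPoints`) and is the unique fixed neighbour (§3), so no child of `v` is fixed. [cite: Kottwitz1986, §3]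
[cite: Serre1980Trees, II.1.1] [cite: Tits1979, §3.5] [cite: BruhatTits1972, §10] -/
theorem fixedGrandchildren_eq_empty_of_levelZero (hσ : ∀ x, σ (σ x) = x) (hvσ : ∀ a, Valued.v (σ a) = Valued.v a) (hσϖ : σ ϖ = -ϖ)
    (hϖ : Valued.v ϖ = WithZero.exp (-1 : ℤ)) (h2 : Valued.v (2 : K) = 1)
    (hT : (latticeGraph σ ϖ ((StdForm.antidiagonal 3).over K)).IsTree)
    {γ : unitaryGroupOfForm σ ((StdForm.antidiagonal 3).over K)} (hγ0 : γ ∈ unitaryInt σ ((StdForm.antidiagonal 3).over K))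
    {v : {M : Submodule 𝒪[K] (Fin 3 → K) // IsVertex σ ϖ ((StdForm.antidiagonal 3).over K) M}}
    (hv : IsSelfDualLattice σ ϖ ((StdForm.antidiagonal 3).over K) v.1) (hvr : v ≠ ⟨stdLattice K 3, 0, isSelfDualLattice_stdLattice_three_of_v hϖ⟩)
    (hfix : latticeGraphIso σ ϖ ((StdForm.antidiagonal 3).over K) γ v = v)
    (hrk : ¬ v.1.map ((Matrix.toLin' ((((γ : GL (Fin 3) K) : Matrix (Fin 3) (Fin 3) K) - 1) ^ 2)).restrictScalars 𝒪[K]) ≤ scaleLattice ϖ v.1)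
    (hnil : v.1.map ((Matrix.toLin' ((((γ : GL (Fin 3) K) : Matrix (Fin 3) (Fin 3) K) - 1) ^ 3)).restrictScalars 𝒪[K]) ≤ scaleLattice ϖ v.1) :
    {w | ∃ c, ((latticeGraph σ ϖ ((StdForm.antidiagonal 3).over K)).Adj v c ∧
          (latticeGraph σ ϖ ((StdForm.antidiagonal 3).over K)).dist ⟨stdLattice K 3, 0, isSelfDualLattice_stdLattice_three_of_v hϖ⟩ c = (latticeGraph σ ϖ ((StdForm.antidiagonal 3).over K)).dist ⟨stdLattice K 3, 0, isSelfDualLattice_stdLattice_three_of_v hϖ⟩ v + 1 ∧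
          latticeGraphIso σ ϖ ((StdForm.antidiagonal 3).over K) γ c = c) ∧
        ((latticeGraph σ ϖ ((StdForm.antidiagonal 3).over K)).Adj c w ∧
          (latticeGraph σ ϖ ((StdForm.antidiagonal 3).over K)).dist ⟨stdLattice K 3, 0, isSelfDualLattice_stdLattice_three_of_v hϖ⟩ w = (latticeGraph σ ϖ ((StdForm.antidiagonal 3).over K)).dist ⟨stdLattice K 3, 0, isSelfDualLattice_stdLattice_three_of_v hϖ⟩ c + 1 ∧
          latticeGraphIso σ ϖ ((StdForm.antidiagonal 3).over K) γ w = w)} = ∅ := by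
  classical
  set G := latticeGraph σ ϖ ((StdForm.antidiagonal 3).over K) with hG
  set r : {M : Submodule 𝒪[K] (Fin 3 → K) // IsVertex σ ϖ ((StdForm.antidiagonal 3).over K) M} := ⟨stdLattice K 3, 0, isSelfDualLattice_stdLattice_three_of_v hϖ⟩ with hr
  have hϖ0 : ϖ ≠ 0 := uniformizer_ne_zero hϖ
  have hϖ1 : Valued.v ϖ < 1 := by rw [hϖ, ← WithZero.exp_zero]; exact WithZero.exp_lt_exp.2 (by norm_num)
  have hlt1 : ∀ z : K, Valued.v z < 1 ↔ Valued.v z ≤ Valued.v ϖ := fun z => by rw [hϖ]; exact v_lt_one_iff z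
  obtain ⟨p, hpar, hchild, -, -⟩ := exists_rooted_parent hT r
  have hγr : latticeGraphIso σ ϖ ((StdForm.antidiagonal 3).over K) γ r = r := Subtype.ext (by rw [latticeGraphIso_apply_val]; exact mapGL_stdLattice_of_mem_unitaryInt hγ0)
  have hPC := parentClosed_fixedPoints hT r (latticeGraphIso σ ϖ ((StdForm.antidiagonal 3).over K) γ) hγr
  -- `v = u·L₀`, `γ′ = u⁻¹γu ∈ K₀`
  obtain ⟨u, hu⟩ := exists_latticeGraphIso_root_eq_of_v_two hσ hvσ hϖ h2 v hv (isSelfDualLattice_stdLattice_three_of_v hϖ)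
  subst hu
  have hvr' : latticeGraphIso σ ϖ ((StdForm.antidiagonal 3).over K) u r ≠ r := hvr
  have hγK : u⁻¹ * γ * u ∈ unitaryInt σ ((StdForm.antidiagonal 3).over K) := mem_unitaryInt_conj_of_latticeGraphIso_apply_root_eq hfix
  -- the integral matrix `N₀ = γ′ − 1` and its reduction
  have hNO : ∀ i j, (((((u⁻¹ * γ * u : unitaryGroupOfForm σ ((StdForm.antidiagonal 3).over K))) : GL (Fin 3) K) : Matrix (Fin 3) (Fin 3) K) - 1) i j ∈ 𝒪[K] := by
    intro i j
    rw [Matrix.sub_apply]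
    refine Subring.sub_mem _ ((Valuation.mem_integer_iff _ _).2 ((mem_unitaryInt_iff.1 hγK).1 i j)) ((Valuation.mem_integer_iff _ _).2 ?_)
    by_cases hij : i = j
    · subst hij; simp
    · simp [Matrix.one_apply_ne hij]
  set N₀ : Matrix (Fin 3) (Fin 3) 𝒪[K] := fun i j => ⟨_, hNO i j⟩ with hN₀def
  have hN₀ : ∀ i j, ((N₀ i j : 𝒪[K]) : K) = (((((u⁻¹ * γ * u : unitaryGroupOfForm σ ((StdForm.antidiagonal 3).over K))) : GL (Fin 3) K) : Matrix (Fin 3) (Fin 3) K) - 1) i j := fun _ _ => rfl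
  have hN₀map : (Subring.subtype 𝒪[K]).mapMatrix N₀ = ((((u⁻¹ * γ * u : unitaryGroupOfForm σ ((StdForm.antidiagonal 3).over K))) : GL (Fin 3) K) : Matrix (Fin 3) (Fin 3) K) - 1 := by
    ext i j; rfl
  have hpowcoe : ∀ n i j, ((((((u⁻¹ * γ * u : unitaryGroupOfForm σ ((StdForm.antidiagonal 3).over K))) : GL (Fin 3) K) : Matrix (Fin 3) (Fin 3) K) - 1) ^ n) i j = (((N₀ ^ n) i j : 𝒪[K]) : K) := by
    intro n i j
    rw [← hN₀map, ← map_pow, RingHom.mapMatrix_apply, Matrix.map_apply]; rfl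
  have hpowres : ∀ n, (N₀.map (IsLocalRing.residue 𝒪[K])) ^ n = (N₀ ^ n).map (IsLocalRing.residue 𝒪[K]) := by
    intro n
    rw [← RingHom.mapMatrix_apply, ← RingHom.mapMatrix_apply, map_pow]
  -- the tokens, read on `γ′` (★ FILE H dictionary): `u·L₀ = latt u`, `u⁻¹ A u`
  have hUdet : IsUnit ((u : GL (Fin 3) K) : Matrix (Fin 3) (Fin 3) K).det := Matrix.isUnits_det_units _
  have hlatt : (latticeGraphIso σ ϖ ((StdForm.antidiagonal 3).over K) u r).1 = latt ((u : GL (Fin 3) K) : Matrix (Fin 3) (Fin 3) K) := rfl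
  have hconj : ∀ n : ℕ, ((u : GL (Fin 3) K) : Matrix (Fin 3) (Fin 3) K)⁻¹ * (((γ : GL (Fin 3) K) : Matrix (Fin 3) (Fin 3) K) - 1) ^ n * ((u : GL (Fin 3) K) : Matrix (Fin 3) (Fin 3) K) =
      (((((u⁻¹ * γ * u : unitaryGroupOfForm σ ((StdForm.antidiagonal 3).over K))) : GL (Fin 3) K) : Matrix (Fin 3) (Fin 3) K) - 1) ^ n := by
    intro n
    rw [← Matrix.coe_units_inv, ← Units.conj_pow', Matrix.mul_sub, Matrix.sub_mul, Matrix.mul_one, Units.inv_mul,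
      Subgroup.coe_mul, Subgroup.coe_mul, Subgroup.coe_inv, Units.val_mul, Units.val_mul]
  rw [hlatt, map_toLin'_latt_le_scaleLattice_iff hϖ0 _ hUdet, hconj] at hrk hnil
  -- residually: `N̄³ = 0`, `N̄² ≠ 0`
  have h3 : (N₀.map (IsLocalRing.residue 𝒪[K])) ^ 3 = 0 := by
    rw [hpowres]
    ext i j
    rw [Matrix.map_apply, Matrix.zero_apply, residue_eq_zero_iff_v_lt_one, ← hpowcoe, hlt1]
    exact hnil i j
  have hsq : (N₀.map (IsLocalRing.residue 𝒪[K])) ^ 2 ≠ 0 := by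
    intro h0
    apply hrk
    intro i j
    have hij := congrFun (congrFun h0 i) j
    rw [hpowres, Matrix.map_apply, Matrix.zero_apply, residue_eq_zero_iff_v_lt_one, ← hpowcoe] at hij
    exact (hlt1 _).1 hij
  -- the parent is fixed; any fixed child would equal the parent
  obtain ⟨hpadj, hpdist⟩ := hpar _ hvr'
  have hpfix : latticeGraphIso σ ϖ ((StdForm.antidiagonal 3).over K) γ (p (latticeGraphIso σ ϖ ((StdForm.antidiagonal 3).over K) u r)) = p (latticeGraphIso σ ϖ ((StdForm.antidiagonal 3).over K) u r) := hPC _ hfix hvr' _ hpadj hpdist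
  ext w
  simp only [Set.mem_setOf_eq, Set.mem_empty_iff_false, iff_false, not_exists, not_and]
  intro c hc _ _ _
  obtain ⟨hadj, hdc, hcfix⟩ := hc
  have hcp : c = p (latticeGraphIso σ ϖ ((StdForm.antidiagonal 3).over K) u r) :=
    fixed_neighbor_unique_of_levelZero hσ hvσ hσϖ hϖ h2 hγK N₀ hN₀ h3 hsq
      ((SimpleGraph.mem_neighborSet _ _ _).2 hadj) ((SimpleGraph.mem_neighborSet _ _ _).2 hpadj) hcfix hpfix
  rw [hcp, hr] at hdc
  rw [hG, hr] at hpdist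
  omega

end Literature.NumberTheory.Automorphic.UnitaryLatticeTree

end
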